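import Summits.KontsevichZagierPeriods.KontsevichZagierPeriods.Theses.SymplecticScissors
import Literature.NumberTheory.Transcendental.AyoubPeriodSeries
import Literature.NumberTheory.Transcendental.AyoubPeriodSeriesKernel
import Literature.NumberTheory.Transcendental.AyoubPeriodSeriesLocalizing
import Literature.NumberTheory.Transcendental.AyoubPeriodSeriesProofs
import Summits.KontsevichZagierPeriods.KontsevichZagierPeriods.Theorems.SymplecticScissorsTypeAGenerationStubExactDlogAux
import Summits.KontsevichZagierPeriods.KontsevichZagierPeriods.Theorems.SymplecticScissorsTypeAGenerationStubCovSubstAnalyticAux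
import Summits.KontsevichZagierPeriods.KontsevichZagierPeriods.Theorems.SymplecticScissorsTypeAGenerationStubCovPolyAux
import Mathlib.RingTheory.MvPowerSeries.Substitution

/-!
# `TypeAGeneration` (stmt-KontsevichZagierPeriods-18392), line `Sketch`, stub
`stub_covSubstAnalytic` (V0): the analytic/formal substitution package for Ayoub's change of
variables in dimension one

Registered stub `stub_covSubstAnalytic` of the crux `TypeAGeneration` (route SymplecticScissors,
line `Sketch`), on top of `Literature/NumberTheory/Transcendental/AyoubPeriodSeries.lean`
(`AyoubRel.CSeries = ℂ[[z₀, z₁, …]]`, `AyoubRel.UsesVar`), Mathlib's substitution API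
`MvPowerSeries.subst` / `MvPowerSeries.HasSubst`, the weighted `ℓ¹` bookkeeping of the sibling
stub files (`stub_weightedNormMul` (U0): `N_ρ(F G) ≤ N_ρ(F) N_ρ(G)`; `d1_hasSum_norm_add/one`,
`d1_hasSum_axis`) and the auxiliary file `…StubCovSubstAnalyticAux.lean` (substitution of a
one-variable series `f = Σ_n f_n zᵢⁿ` into `zᵢ ↦ G`, `G(0) = 0`: `v0_hasSubst`, the coefficient
formula `v0_coeff_subst`, the variables `v0_usesVar_subst`, the tail weights `v0_subst_weights`).

For a polynomial `u ∈ ℂ[X]` with `u(0) = 0` and the straight-line homotopy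
`H = zᵢ(1 − z_j) + u(zᵢ) z_j` (`i ≠ j`), both `G = H` and `G = u(zᵢ)` have `G(0) = 0`, so the
auxiliary file applies to `f(H) = MvPowerSeries.subst (zᵢ ↦ H) f` and
`f(u(zᵢ)) = MvPowerSeries.subst (zᵢ ↦ u(zᵢ)) f`. This file supplies the specific inputs:

* the coefficients of `u(zᵢ)` (`v0_coeff_aeval`: `u_{aᵢ}` on the `zᵢ`-axis, `0` off it), whence
  `u(zᵢ)(0) = u(0) = 0` and `N_ρ(u(zᵢ)) = Σ_k |u_k| ρ^k` (`u(zᵢ)` involves only `zᵢ`: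
  `c3_usesVar_aeval` of `…StubCovPolyAux.lean`);
* `N_ρ(zₘ) = ρ`, the variables of `zₘ` and of `1 − z_j`, `H(0) = 0`, `H` involves only `zᵢ, z_j`;
* `N_ρ(H) ≤ ρ(1 + ρ) + ρ Σ_k |u_k| ρ^k` (`v0_norm_covH`), which is `< r` for some `ρ > 1` when
  `2 + Σ_k |u_k| < r` (continuity at `ρ = 1`, `v0_exists_rho`); with `q` this bound,
  `N_ρ(u(zᵢ)) ≤ q` as well, and the tails `Σ_{n ≥ N} |f_n| qⁿ → 0` give the `N_ρ`-convergence of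
  `Σ_{n<N} f_n Hⁿ` to `f(H)`.

Elementary (folklore); no definition is introduced (`H` and the two families are local notations).
-/

noncomputable section

-- `Summit.KontsevichZagierPeriods.KontsevichZagierPeriods.…` is the tree's mandated layout (single-conjunct summit).
set_option linter.dupNamespace false

namespace Summit.KontsevichZagierPeriods.KontsevichZagierPeriods.TypeAGenerationLine

open Finsupp MvPowerSeries
open Literature.NumberTheory.Transcendental
open Literature.NumberTheory.Transcendental.AyoubRel

/-- The straight-line homotopy `H = zᵢ(1 − z_j) + u(zᵢ) z_j`. -/
local notation3 "covH[" i ", " j ", " u "]" =>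
  ((X i : CSeries) * (1 - X j) + Polynomial.aeval (X i : CSeries) u * X j)

/-- The substitution family `zᵢ ↦ H`, `z_l ↦ z_l` (`l ≠ i`). -/
local notation3 "covFam[" i ", " j ", " u "]" =>
  (fun l : ℕ => if l = i then covH[i, j, u] else (X l : CSeries))

/-- The substitution family `zᵢ ↦ u(zᵢ)`, `z_l ↦ z_l` (`l ≠ i`). -/
local notation3 "uFam[" i ", " u "]" =>
  (fun l : ℕ => if l = i then Polynomial.aeval (X i : CSeries) u else (X l : CSeries))

/-! ## The polynomial `u(zᵢ)`, the variables `zₘ` and the homotopy `H` -/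

/-- `u(zᵢ) = Σ_{k ∈ supp u} u_k zᵢ^k`. [folklore] -/
theorem v0_aeval_eq (i : ℕ) (u : Polynomial ℂ) :
    Polynomial.aeval (X i : CSeries) u = ∑ k ∈ u.support, u.coeff k • (X i : CSeries) ^ k := by
  conv_lhs => rw [u.as_sum_support]
  rw [map_sum]
  refine Finset.sum_congr rfl fun k _ => ?_
  rw [Polynomial.aeval_monomial, Algebra.smul_def]

/-- **Coefficients of `u(zᵢ)`**: `u_{aᵢ}` on the `zᵢ`-axis, `0` off it. [folklore] -/
theorem v0_coeff_aeval (i : ℕ) (u : Polynomial ℂ) (a : ℕ →₀ ℕ) :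
    coeff a (Polynomial.aeval (X i : CSeries) u) =
      if a = single i (a i) then u.coeff (a i) else 0 := by
  classical
  rw [v0_aeval_eq, map_sum]
  simp only [coeff_smul, coeff_X_pow, mul_ite, mul_one, mul_zero]
  by_cases ha : a = single i (a i)
  · rw [if_pos ha]
    have heq : ∀ k : ℕ, (a = single i k ↔ a i = k) := fun k =>
      ⟨fun h => by rw [h, single_eq_same], fun h => by rw [← h]; exact ha⟩
    simp only [heq]
    rw [Finset.sum_ite_eq]
    split_ifs with hmem
    · rfl
    · exact (Polynomial.notMem_support_iff.mp hmem).symm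
  · rw [if_neg ha]
    refine Finset.sum_eq_zero fun k _ => ?_
    rw [if_neg]
    intro h
    apply ha
    rw [h, single_eq_same]

/-- `u(zᵢ)(0) = u(0)`; so `u(zᵢ)` has zero constant coefficient when `u(0) = 0`. [folklore] -/
theorem v0_constantCoeff_aeval (i : ℕ) {u : Polynomial ℂ} (hu : u.eval 0 = 0) :
    constantCoeff (Polynomial.aeval (X i : CSeries) u) = 0 := by
  rw [← coeff_zero_eq_constantCoeff_apply, v0_coeff_aeval, Finsupp.zero_apply, single_zero,
    if_pos rfl, Polynomial.coeff_zero_eq_eval_zero, hu]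

/-- `N_ρ(u(zᵢ)) = Σ_k |u_k| ρ^k`. [folklore] -/
theorem v0_hasSum_aeval (ρ : ℝ) (i : ℕ) (u : Polynomial ℂ) :
    HasSum (fun a : ℕ →₀ ℕ =>
      ‖coeff a (Polynomial.aeval (X i : CSeries) u)‖ * a.prod fun _ n => ρ ^ n)
      (∑ k ∈ u.support, ‖u.coeff k‖ * ρ ^ k) := by
  refine d1_hasSum_axis (i := i) (fun x hx => ?_) ρ ?_
  · rw [v0_coeff_aeval, if_neg (hx (x i))]
  · have h : ∀ n : ℕ, coeff (single i n) (Polynomial.aeval (X i : CSeries) u) = u.coeff n :=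
      fun n => by rw [v0_coeff_aeval, single_eq_same, if_pos rfl]
    simp only [h]
    exact hasSum_sum_of_ne_finset_zero fun k hk => by
      rw [Polynomial.notMem_support_iff.mp hk, norm_zero, zero_mul]

/-- `N_ρ(zₘ) = ρ`. [folklore] -/
theorem v0_hasSum_X (ρ : ℝ) (m : ℕ) :
    HasSum (fun a : ℕ →₀ ℕ => ‖coeff a (X m : CSeries)‖ * a.prod fun _ n => ρ ^ n) ρ := by
  classical
  have h : (fun a : ℕ →₀ ℕ => ‖coeff a (X m : CSeries)‖ * a.prod fun _ n => ρ ^ n) =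
      fun a => if a = single m 1 then ρ else 0 := by
    funext a
    rw [coeff_X]
    split_ifs with ha
    · rw [ha, norm_one, one_mul, s4_prod_const_pow, degree_single, pow_one]
    · rw [norm_zero, zero_mul]
  rw [h]
  exact hasSum_ite_eq _ _

/-- `N_ρ(−zₘ) = ρ`. [folklore] -/
theorem v0_hasSum_neg_X (ρ : ℝ) (m : ℕ) :
    HasSum (fun a : ℕ →₀ ℕ => ‖coeff a (-(X m : CSeries))‖ * a.prod fun _ n => ρ ^ n) ρ :=
  (v0_hasSum_X ρ m).congr_fun fun a => by rw [map_neg, norm_neg]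

/-- `zₘ` involves only `zₘ`. [folklore] -/
theorem v0_usesVar_X {m l : ℕ} (h : UsesVar (X m : CSeries) l) : l = m := by
  classical
  obtain ⟨a, hal, hne⟩ := h
  rw [coeff_X] at hne
  split_ifs at hne with ha
  · by_contra hlm
    apply hal
    rw [ha, single_eq_of_ne hlm]
  · exact absurd rfl hne

/-- `1 − z_j` involves only `z_j`. [folklore] -/
theorem v0_usesVar_one_sub_X {j l : ℕ} (h : UsesVar (1 - X j : CSeries) l) : l = j := by
  classical
  obtain ⟨a, hal, hne⟩ := h
  by_contra hlj
  apply hne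
  have ha0 : a ≠ 0 := fun h0 => hal (by rw [h0, Finsupp.zero_apply])
  have ha1 : a ≠ single j 1 := fun h1 => hal (by rw [h1, single_eq_of_ne hlj])
  rw [map_sub, coeff_one, if_neg ha0, coeff_X, if_neg ha1, sub_zero]

/-- `H(0) = 0`. [folklore] -/
theorem v0_constantCoeff_covH (i j : ℕ) (u : Polynomial ℂ) : constantCoeff covH[i, j, u] = 0 := by
  simp only [map_add, map_mul, constantCoeff_X, zero_mul, mul_zero, add_zero]

/-- `H` involves only `zᵢ` and `z_j`. [folklore] -/
theorem v0_usesVar_covH {i j l : ℕ} {u : Polynomial ℂ} (h : UsesVar covH[i, j, u] l) :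
    l = i ∨ l = j := by
  rcases s6_usesVar_add h with h | h
  · rcases usesVar_mul h with h | h
    · exact Or.inl (v0_usesVar_X h)
    · exact Or.inr (v0_usesVar_one_sub_X h)
  · rcases usesVar_mul h with h | h
    · exact Or.inl (c3_usesVar_aeval h)
    · exact Or.inr (v0_usesVar_X h)

/-- **`N_ρ(H) ≤ ρ(1 + ρ) + ρ Σ_k |u_k| ρ^k`** (`N_ρ(zₘ) = ρ`, `N_ρ(1 − z_j) ≤ 1 + ρ`,
`N_ρ(u(zᵢ)) = Σ_k |u_k| ρ^k`, subadditivity and submultiplicativity U0). [folklore] -/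
theorem v0_norm_covH {ρ : ℝ} (hρ : 0 ≤ ρ) (i j : ℕ) (u : Polynomial ℂ) :
    ∃ Q : ℝ, Q ≤ ρ * (1 + ρ) + (∑ k ∈ u.support, ‖u.coeff k‖ * ρ ^ k) * ρ ∧
      HasSum (fun a : ℕ →₀ ℕ => ‖coeff a covH[i, j, u]‖ * a.prod fun _ n => ρ ^ n) Q := by
  have hρ' : ∀ l : ℕ, 0 ≤ (fun _ : ℕ => ρ) l := fun _ => hρ
  obtain ⟨B, hB, hBs⟩ :=
    d1_hasSum_norm_add hρ' (d1_hasSum_norm_one (fun _ : ℕ => ρ)) (v0_hasSum_neg_X ρ j)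
  rw [← sub_eq_add_neg] at hBs
  obtain ⟨P₁, hP₁, hP₁s⟩ := stub_weightedNormMul _ _ (fun _ => ρ) hρ' _ _ (v0_hasSum_X ρ i) hBs
  obtain ⟨P₂, hP₂, hP₂s⟩ :=
    stub_weightedNormMul _ _ (fun _ => ρ) hρ' _ _ (v0_hasSum_aeval ρ i u) (v0_hasSum_X ρ j)
  obtain ⟨Q, hQ, hQs⟩ := d1_hasSum_norm_add hρ' hP₁s hP₂s
  refine ⟨Q, hQ.trans ?_, hQs⟩
  have h1 : P₁ ≤ ρ * (1 + ρ) := hP₁.trans (mul_le_mul_of_nonneg_left hB hρ)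
  linarith

/-- **Choice of `ρ`**: `ρ(1 + ρ) + ρ Σ_k |u_k| ρ^k → 2 + Σ_k |u_k| < r` as `ρ → 1`, so some `ρ > 1`
keeps it `< r` (continuity). [folklore] -/
theorem v0_exists_rho (u : Polynomial ℂ) {r : ℝ} (hr : 2 + (∑ n ∈ u.support, ‖u.coeff n‖) < r) :
    ∃ ρ : ℝ, 1 < ρ ∧ ρ * (1 + ρ) + (∑ k ∈ u.support, ‖u.coeff k‖ * ρ ^ k) * ρ < r := by
  have hc : Continuous fun ρ : ℝ => ρ * (1 + ρ) + (∑ k ∈ u.support, ‖u.coeff k‖ * ρ ^ k) * ρ := by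
    fun_prop
  have h1 : (1 : ℝ) * (1 + 1) + (∑ k ∈ u.support, ‖u.coeff k‖ * (1 : ℝ) ^ k) * 1 < r := by
    simp only [one_pow, mul_one, one_mul]
    linarith
  obtain ⟨ε, hε, hball⟩ :=
    Metric.eventually_nhds_iff.mp (hc.continuousAt.eventually_lt continuousAt_const h1)
  refine ⟨1 + ε / 2, by linarith, hball ?_⟩
  rw [Real.dist_eq, add_sub_cancel_left, abs_of_pos (half_pos hε)]
  exact half_lt_self hε

/-! ## The stub -/

/-- **V0 — the analytic/formal substitution package for the change of variables `zᵢ ↦ u(zᵢ)`**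
(Ayoub's Remark 1.5, dimension one): for `u ∈ ℂ[X]` with `u(0) = 0`, a one-variable `f` in `zᵢ`
of polyradius `r > 2 + Σ_k |u_k|`, and the homotopy `H = zᵢ(1 − z_j) + u(zᵢ) z_j` (`i ≠ j`):
the families `zᵢ ↦ H` and `zᵢ ↦ u(zᵢ)` are substitutable; `f(H)` involves only `zᵢ, z_j` and
`f(u(zᵢ))` only `zᵢ`; `f(H)_a = Σ_{n ≤ |a|} f_n (Hⁿ)_a` and likewise for `u(zᵢ)`; and for some
`ρ > 1`, `q < r`: `N_ρ(H) ≤ q`, `N_ρ(f(H)) < ∞`, `N_ρ(f(u(zᵢ))) < ∞`, and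
`N_ρ(f(H) − Σ_{n<N} f_n Hⁿ) → 0`. Registered stub `stub_covSubstAnalytic` of the crux
stmt-KontsevichZagierPeriods-18392, line `Sketch`. [folklore] -/
theorem stub_covSubstAnalytic :
    ∀ (i j : ℕ), i ≠ j → ∀ (u : Polynomial ℂ), u.eval 0 = 0 →
      ∀ (f : CSeries), (∀ l : ℕ, UsesVar f l → l = i) →
      ∀ (r : ℝ), 2 + (∑ n ∈ u.support, ‖u.coeff n‖) < r →
        Summable (fun a : ℕ →₀ ℕ => ‖MvPowerSeries.coeff a f‖ * r ^ degree a) →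
        MvPowerSeries.HasSubst covFam[i, j, u] ∧ MvPowerSeries.HasSubst uFam[i, u] ∧
        (∀ l : ℕ, UsesVar (MvPowerSeries.subst covFam[i, j, u] f) l → l = i ∨ l = j) ∧
        (∀ l : ℕ, UsesVar (MvPowerSeries.subst uFam[i, u] f) l → l = i) ∧
        (∀ a : ℕ →₀ ℕ, MvPowerSeries.coeff a (MvPowerSeries.subst covFam[i, j, u] f) =
          ∑ n ∈ Finset.range (degree a + 1),
            MvPowerSeries.coeff (Finsupp.single i n) f * MvPowerSeries.coeff a (covH[i, j, u] ^ n)) ∧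
        (∀ a : ℕ →₀ ℕ, MvPowerSeries.coeff a (MvPowerSeries.subst uFam[i, u] f) =
          ∑ n ∈ Finset.range (degree a + 1),
            MvPowerSeries.coeff (Finsupp.single i n) f *
              MvPowerSeries.coeff a (Polynomial.aeval (X i : CSeries) u ^ n)) ∧
        (∃ ρ : ℝ, 1 < ρ ∧ ∃ q : ℝ, q < r ∧
          (∃ Q : ℝ, Q ≤ q ∧ HasSum (fun a : ℕ →₀ ℕ =>
            ‖MvPowerSeries.coeff a (covH[i, j, u])‖ * a.prod fun _ n => ρ ^ n) Q) ∧
          (Summable fun a : ℕ →₀ ℕ =>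
            ‖MvPowerSeries.coeff a (MvPowerSeries.subst covFam[i, j, u] f)‖ * a.prod fun _ n => ρ ^ n) ∧
          (Summable fun a : ℕ →₀ ℕ =>
            ‖MvPowerSeries.coeff a (MvPowerSeries.subst uFam[i, u] f)‖ * a.prod fun _ n => ρ ^ n) ∧
          (∀ ε : ℝ, 0 < ε → ∃ N : ℕ, ∀ N' : ℕ, N ≤ N' → ∃ E : ℝ, E < ε ∧
            HasSum (fun a : ℕ →₀ ℕ => ‖MvPowerSeries.coeff a
              (MvPowerSeries.subst covFam[i, j, u] f -
                ∑ n ∈ Finset.range N', MvPowerSeries.coeff (Finsupp.single i n) f • covH[i, j, u] ^ n)‖ *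
              a.prod fun _ n => ρ ^ n) E)) := by
  intro i j _ u hu f hf r hr hs
  have hH0 : constantCoeff covH[i, j, u] = 0 := v0_constantCoeff_covH i j u
  have hP0 : constantCoeff (Polynomial.aeval (X i : CSeries) u) = 0 := v0_constantCoeff_aeval i hu
  refine ⟨v0_hasSubst i hH0, v0_hasSubst i hP0,
    fun l hl => v0_usesVar_covH (v0_usesVar_subst hf hH0 hl),
    fun l hl => c3_usesVar_aeval (v0_usesVar_subst hf hP0 hl),
    fun a => v0_coeff_subst hf hH0 a (Nat.lt_succ_self _),
    fun a => v0_coeff_subst hf hP0 a (Nat.lt_succ_self _), ?_⟩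
  obtain ⟨ρ, hρ1, hρr⟩ := v0_exists_rho u hr
  have hρ0 : 0 ≤ ρ := zero_le_one.trans hρ1.le
  set Su : ℝ := ∑ k ∈ u.support, ‖u.coeff k‖ * ρ ^ k with hSu
  have hSu0 : 0 ≤ Su := Finset.sum_nonneg fun k _ => mul_nonneg (norm_nonneg _) (pow_nonneg hρ0 k)
  set q : ℝ := ρ * (1 + ρ) + Su * ρ with hq
  have hSuq : Su ≤ q := by
    have h1 : Su * 1 ≤ Su * ρ := mul_le_mul_of_nonneg_left hρ1.le hSu0
    have h2 : 0 ≤ ρ * (1 + ρ) := by positivity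
    linarith
  have hq0 : 0 ≤ q := hSu0.trans hSuq
  obtain ⟨Q, hQ, hQs⟩ := v0_norm_covH hρ0 i j u
  have hPs := v0_hasSum_aeval ρ i u
  have hsq : Summable fun n : ℕ => ‖coeff (single i n) f‖ * q ^ n :=
    v0_summable_axis i hs hq0 hρr.le
  refine ⟨ρ, hρ1, q, hρr, ⟨Q, hQ, hQs⟩, ?_, ?_, fun ε hε => ?_⟩
  · obtain ⟨E, -, hE⟩ := v0_subst_weights hρ0 hH0 hQ hQs hf hsq 0
    rw [Finset.sum_range_zero, sub_zero] at hE
    exact hE.summable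
  · obtain ⟨E, -, hE⟩ := v0_subst_weights hρ0 hP0 hSuq hPs hf hsq 0
    rw [Finset.sum_range_zero, sub_zero] at hE
    exact hE.summable
  · have ht := tendsto_sum_nat_add fun n : ℕ => ‖coeff (single i n) f‖ * q ^ n
    rw [Metric.tendsto_atTop] at ht
    obtain ⟨N, hN⟩ := ht ε hε
    refine ⟨N, fun N' hN' => ?_⟩
    obtain ⟨E, hE, hEs⟩ := v0_subst_weights hρ0 hH0 hQ hQs hf hsq N'
    refine ⟨E, lt_of_le_of_lt hE ?_, hEs⟩
    have h := hN N' hN'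
    rw [Real.dist_0_eq_abs] at h
    exact lt_of_le_of_lt (le_abs_self _) h

end Summit.KontsevichZagierPeriods.KontsevichZagierPeriods.TypeAGenerationLine
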